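import Literature.Computability.Complexity.DrivenSignMachineDriver
import Literature.Computability.Complexity.HashBricks
import HarnessLib

/-!
# The oracle-driven sign machine, VI: witnesses that carry their own probe (generic transmission)

Topic `Literature/Computability/Complexity`, grouping namespace `FKTransfer`, sequel of
`DrivenSignMachineDriver.lean`. In a frame of the driven sign machine the driver first finds a
witness `w` (prefix search, `s` rounds) and then spells out the code of the form to probe
(`m` rounds). If the strategy lets the witness CARRY that code as its last `m` bits —
`code h w = carryCode m w := w ⇂ (|w| - m)` (right-padded to length `m`), the admissibility predicate `R h w` constraining those
bits — then transmission becomes problem-independent: the bit to send after the partial block `p`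
is bit `|bits| - m` of the transcript `bits = flat h ++ w ++ p` (`getD_carry_index`). So

* `TransLang m = {⟨1ⁿ, bits⟩ | bits[|bits| - m(n)] = 1}` is ONE transmission language for all
  strategies, and it is in `P` (`TransLang_mem_P`: `polyFn`, `dropFn`, `onesFn`, `bitAtFn`,
  `headBitFn`);
* **`implements_driverLang_carry`**: with `Ltrans := TransLang m` and `code := carryCode`, the
  driver `driverLang s m F Lsearch (TransLang m) Lfinal` implements the strategy as soon as
  `Lsearch` answers the prefix-search questions — the only problem-specific pieces left are
  `Lsearch` (where all arithmetic can be GUESSED and VERIFIED, i.e. done in `NP`) and `Lfinal`.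

For Fournier–Koiran's procedure (ICALP 2000 = LIP RR-1999-21, §2.1–2.2) this means that the
lifted tests `Aff(s¹, Aff(s², …))` never have to be COMPUTED by a polynomial-time function in the
formalisation: the `NP` witness of a frame contains them and the verifier checks the lift identities.

## References

* H. Fournier, P. Koiran, *Lower bounds are not easier over the reals: inside PH*, ICALP 2000,
  LNCS 1853 = LIP RR-1999-21, §2.1 (prefix search, tests), §2.2 (polynomial size of the tests).
  [FournierKoiran2000]
-/

namespace Literature.Computability.Complexity

namespace FKTransfer

open _root_.Computability Polynomial Brick

/-- Length of a unary numeral. [folklore] -/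
private theorem length_unaryEncodeNat (k : ℕ) : (unaryEncodeNat k).length = k := by
  induction k with
  | zero => rfl
  | succ k ih => rw [unaryEncodeNat, List.length_cons, ih]

/-- Unary numerals are blocks of ones. [folklore] -/
private theorem unaryEncodeNat_eq_ones (k : ℕ) : unaryEncodeNat k = ones k := by
  induction k with
  | zero => rfl
  | succ k ih => rw [unaryEncodeNat, ih]; rfl

/-! ### Witnesses carrying their probe -/

/-- The code carried by a witness: its last `m` bits (right-padded with zeros to length `m` by
core's `List.rightpad` when the witness is shorter, so that the length is `m` unconditionally).
[cite: FournierKoiran2000, §2.1 (the test follows the object found)] -/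
def carryCode (m : ℕ) (w : List Bool) : List Bool :=
  List.rightpad m false (w.drop (w.length - m))

/-- The carried code has length `m`. [folklore] -/
@[simp] theorem length_carryCode (m : ℕ) (w : List Bool) : (carryCode m w).length = m := by
  rw [carryCode, List.length_rightpad, List.length_drop]
  omega

/-- For a long enough witness the carried code is exactly its last `m` bits. [folklore] -/
theorem carryCode_eq_drop {m : ℕ} {w : List Bool} (h : m ≤ w.length) : carryCode m w = w.drop (w.length - m) := by
  rw [carryCode, List.rightpad, List.length_drop, show m - (w.length - (w.length - m)) = 0 by omega,
    List.replicate_zero, List.append_nil]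

/-- **The bit to transmit is `m` positions before the end of the transcript**: after the history
transcript `t`, a witness `w` (`m ≤ |w|`) and a partial block `p` (`|p| < m`), bit `|p|` of the
carried code is bit `|t ++ w ++ p| - m` of `t ++ w ++ p`. [folklore] -/
theorem getD_carry_index (t w p : List Bool) {m : ℕ} (hm : m ≤ w.length) (hp : p.length < m) :
    (t ++ w ++ p).getD ((t ++ w ++ p).length - m) false = (carryCode m w).getD p.length false := by
  rw [carryCode_eq_drop hm, List.getD_eq_getElem?_getD, List.getD_eq_getElem?_getD, List.getElem?_drop,
    List.length_append, List.length_append, List.append_assoc,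
    List.getElem?_append_right (by omega), List.getElem?_append_left (by omega)]
  congr 2
  omega

/-! ### The generic transmission language -/

section Trans

variable (m : Polynomial ℕ)

/-- The one-bit function `⟨1ⁿ, bits⟩ ↦ [bits[|bits| - m(n)]]` (`false` past the end). [folklore] -/
noncomputable def transBitFn : List Bool → List Bool :=
  HashBricks.headBitFn ∘ bitAtFn ∘
    fanoutFn (Plumb.dropFn ∘ fanoutFn (Plumb.polyFn m ∘ fstF) (onesFn ∘ sndF)) sndF

/-- **The generic transmission language**: `⟨1ⁿ, bits⟩` with bit `|bits| - m(n)` of `bits` set.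
[cite: FournierKoiran2000, §2 (p. 4: the query is written bit by bit)] -/
def TransLang : Language Bool :=
  {z | transBitFn m z = [true]}

variable {m}

/-- Value of `transBitFn`. [folklore] -/
theorem transBitFn_apply (n : ℕ) (bits : List Bool) :
    transBitFn m (boolPair (unaryEncodeNat n) bits) = [bits.getD (bits.length - m.eval n) false] := by
  simp only [transBitFn, Function.comp_apply, fanoutFn_apply, fstF_boolPair, sndF_boolPair,
    Plumb.polyFn_apply, length_unaryEncodeNat, onesFn, Plumb.dropFn_boolPair, bitAtFn_boolPair,
    HashBricks.headBitFn_apply]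
  rw [unaryEncodeNat_eq_ones, show ((ones bits.length).drop (ones (m.eval n)).length).length =
    bits.length - m.eval n by simp [ones]]
  rw [List.getD_eq_getElem?_getD, ← List.head?_drop]
  cases bits.drop (bits.length - m.eval n) <;> rfl

/-- `transBitFn ∈ FP`. [folklore] -/
theorem transBitFn_mem_FP : transBitFn m ∈ FP :=
  comp_mem_FP HashBricks.headBitFn_mem_FP (comp_mem_FP bitAtFn_mem_FP
    (fanoutFn_mem_FP (comp_mem_FP Plumb.dropFn_mem_FP (fanoutFn_mem_FP
      (comp_mem_FP (Plumb.polyFn_mem_FP m) fstF_mem_FP) (comp_mem_FP onesFn_mem_FP sndF_mem_FP))) sndF_mem_FP))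

/-- **`TransLang m ∈ P`.** [folklore] -/
theorem TransLang_mem_P : TransLang m ∈ Classes.P :=
  mem_P_of_mem_FP transBitFn_mem_FP _ fun z =>
    ⟨fun h => h, fun h => by
      have h' : transBitFn m z ≠ [true] := h
      have h1 : transBitFn m z = [(bitAtFn (fanoutFn (Plumb.dropFn ∘ fanoutFn (Plumb.polyFn m ∘ fstF)
          (onesFn ∘ sndF)) sndF z)).headD false] := by
        simp only [transBitFn, Function.comp_apply, HashBricks.headBitFn_apply]
      rw [h1] at h' ⊢
      revert h'
      cases (bitAtFn (fanoutFn (Plumb.dropFn ∘ fanoutFn (Plumb.polyFn m ∘ fstF) (onesFn ∘ sndF)) sndF z)).headD false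
        <;> simp⟩

/-- Membership of `⟨1ⁿ, bits⟩` in `TransLang m`. [folklore] -/
theorem boolPair_mem_TransLang {n : ℕ} {bits : List Bool} :
    boolPair (unaryEncodeNat n) bits ∈ TransLang m ↔ bits.getD (bits.length - m.eval n) false = true := by
  change transBitFn m _ = [true] ↔ _
  rw [transBitFn_apply]
  simp

end Trans

/-! ### Implementing a carrying strategy -/

section Implements

variable {s m F : Polynomial ℕ} {Lsearch Lfinal : Language Bool}
  {R : List (List Bool × Bool) → List Bool → Prop} {σ : List Bool → Bool} {n : ℕ}

/-- **A carrying strategy is implemented by the generic transmission language.** With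
`code h w := carryCode (m n) w`, `m(n) ≤ s(n)`, and admissible witnesses of length `s(n)`, the
driver `driverLang s m F Lsearch (TransLang m) Lfinal` implements `(R, code)` at dimension `n` as
soon as `Lsearch` answers the prefix-search questions of `R` on the transcripts of valid histories.
[cite: FournierKoiran2000, §2.1] -/
theorem implements_driverLang_carry (hms : m.eval n ≤ s.eval n)
    (hsR : ∀ h w, R h w → w.length = s.eval n)
    (hS : ∀ (h : List (List Bool × Bool)) (p : List Bool), h.length < F.eval n →
      ValidHist R (fun _ w => carryCode (m.eval n) w) σ h → p.length < s.eval n →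
        (boolPair (unaryEncodeNat n) (flat (fun _ w => carryCode (m.eval n) w) h ++ p) ∈ Lsearch ↔
          PrefixExtendable (R h) (s.eval n) (p ++ [true]))) :
    Implements R (fun _ w => carryCode (m.eval n) w) σ
      (driverOf (driverLang s m F Lsearch (TransLang m) Lfinal) n) (s.eval n) (F.eval n) :=
  implements_driverLang (fun _ w => length_carryCode _ w) hsR hS (fun h w p _ _ hw _ hp => by
    rw [boolPair_mem_TransLang, getD_carry_index _ _ _ (by rw [hw]; exact hms) hp])

end Implements

end FKTransfer

end Literature.Computability.Complexity
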